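import Mathlib
import Summits.Ventures.PercRepro.TriangleCapTableAll
import Summits.Ventures.PercRepro.TriangleCapStar

/-!
# PercRepro — THE `K₄⁻`-FREE CHERRY TABLE IN THE VARIABLES `(k, m)` (p3, gen 33; part 27)

The table as one statement in the natural variables — `k` vertices, `m` edges: for every `m ≤ 2k − 4` the maximum
of `Σ_v C(d(v), 2)` over `K₄⁻`-free graphs with `m` edges on `k` vertices is `C(m, 2)` for `m ≤ k − 1` (the star,
TriangleCapStar) and, for `k ≤ m ≤ 2k − 4` with `t = m + 1 − k`, `max (C(k − 1, 2) + 2t) (C(k − 2, 2) + C(t + 1, 2) + t + 1)`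
(TriangleCapTableAll).  The dense corner `m ≥ 2k − 3` (up to `⌊k²/4⌋`, the `K₄⁻`-free edge maximum) stays census.
Axioms: standard.
-/

namespace PercRepro

namespace TriangleCap

namespace C047

open Finset

/-- **THE `K₄⁻`-FREE CHERRY TABLE FOR `m ≤ 2k − 4`, EXACT:** the maximum of `Σ_v C(d(v), 2)` over `K₄⁻`-free graphs
with `m` edges on `k` vertices is `C(m, 2)` when `m ≤ k − 1`, and otherwise, with `t = m + 1 − k`,
`max (C(k − 1, 2) + 2t) (C(k − 2, 2) + C(t + 1, 2) + t + 1)`. -/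
theorem table_km (k m : ℕ) (hm : m + 4 ≤ 2 * k) :
    (∀ (D : SimpleGraph (Fin k)) [DecidableRel D.Adj], K4mFree D → D.edgeFinset.card = m →
        cherries D ≤ if m + 1 ≤ k then m.choose 2 else
          max ((k - 1).choose 2 + 2 * (m + 1 - k)) ((k - 2).choose 2 + (m + 2 - k).choose 2 + (m + 2 - k))) ∧
      ∃ (D : SimpleGraph (Fin k)) (_ : DecidableRel D.Adj),
        K4mFree D ∧ D.edgeFinset.card = m ∧
          cherries D = if m + 1 ≤ k then m.choose 2 else
            max ((k - 1).choose 2 + 2 * (m + 1 - k)) ((k - 2).choose 2 + (m + 2 - k).choose 2 + (m + 2 - k)) := by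
  by_cases h : m + 1 ≤ k
  · simp only [if_pos h]
    exact star_rows_exact k m h
  · simp only [if_neg h]
    obtain ⟨t, ht⟩ : ∃ t, m = k - 1 + t := ⟨m + 1 - k, by omega⟩
    have e1 : m + 1 - k = t := by omega
    have e2 : m + 2 - k = t + 1 := by omega
    rw [e1, e2]
    obtain ⟨h1, D, inst, hK, hD, hc⟩ := table_exact_all t k (by omega) (by omega)
    refine ⟨fun D _ hK hD => h1 D hK (by omega), D, inst, hK, by omega, hc⟩

end C047

end TriangleCap

end PercRepro
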